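import Mathlib.LinearAlgebra.Matrix.Rank
import Mathlib.LinearAlgebra.Matrix.NonsingularInverse
import Mathlib.LinearAlgebra.Dimension.Finite
import Literature.NumberTheory.Transcendental.PhilipponZeroEstimateP1nProofs
import Literature.NumberTheory.Transcendental.DiazZeroLemmaProofs
import HarnessLib

/-!
# The zero lemma for linear forms in two logarithms (from Philippon's zero estimate)

Topic `Literature/NumberTheory/Transcendental`. The algebraic non-vanishing input of the
interpolation-determinant method for `Λ = b₁ log α₁ - b₂ log α₂` (Laurent 1994;
Laurent–Mignotte–Nesterenko 1995): on the finitely generated subgroup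
`Γ = {(r b₂ + s b₁, α₁^r α₂^s)} ⊂ 𝔾ₐ × 𝔾ₘ` a non-zero polynomial `P(X, Y)` with `deg_X P ≤ K - 1`,
`deg_Y P ≤ L - 1` cannot vanish at all the points with `0 ≤ r < 2R - 1`, `0 ≤ s < 2S - 1` as soon
as `R S > 2 (K-1)(L-1)` and the `R S` points with `r < R`, `s < S` have pairwise distinct
abscissae `r b₂ + s b₁` and pairwise distinct ordinates `α₁^r α₂^s` (`TwoLog.eq_zero_of_vanish`).
This is Philippon's zero estimate (Bull. SMF 1986, Thm. 2.1; here the tree's PROVED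
multiplicity-free case `Philippon1986_GaGm_P1n_holds` on `𝔾ₐ × 𝔾ₘ`, `n = 1`) with
`Σ = {(r b₂ + s b₁, α₁^r α₂^s) ; r < R, s < S} ∋ e`, `Σ(2) ⊆` the big grid: the obstruction subgroup
`H = V × T` is one of `{e}`, `0 × 𝔾ₘ`, `𝔾ₐ × 1`, `G` (a saturated subgroup of `ℤ` is `0` or `ℤ`),
giving respectively `RS ≤ 2(K-1)(L-1)`, `#{abscissae} ≤ 2(K-1)`, `#{ordinates} ≤ 2(L-1)`, `P = 0`.
Consequence (`TwoLog.exists_det_ne_zero`): some `KL` points of the big grid give a non-singular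
`KL × KL` matrix `((r b₂ + s b₁)^k (α₁^r α₂^s)^l)` — the interpolation determinant of LMN 1995.
Everything here is proved; no named facts.

## References

* P. Philippon, *Lemmes de zéros dans les groupes algébriques commutatifs*, Bull. Soc. Math.
  France 114 (1986), 355–383, Thm. 2.1. [Philippon1986]
* M. Laurent, M. Mignotte, Yu. Nesterenko, *Formes linéaires en deux logarithmes et déterminants
  d'interpolation*, J. Number Theory 55 (1995), 285–321 (the zero lemma of §2; not held).
* A. Baker, G. Wüstholz, *Logarithmic Forms and Diophantine Geometry*, CUP 2007, §2.8 p. 35.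
  [BakerWustholz2007]
-/

noncomputable section

open MvPolynomial Finset

namespace Literature.NumberTheory.Transcendental

/-! ### A non-singular maximal minor of an injective matrix -/

/-- **A matrix with independent columns has a non-singular square submatrix on some rows.**
[folklore] -/
theorem exists_submatrix_det_ne_zero {m κ : Type*} [Fintype m] [Fintype κ] [DecidableEq κ]
    (A : Matrix m κ ℂ) (hA : Function.Injective A.mulVec) :
    ∃ ρ : κ → m, Function.Injective ρ ∧ (A.submatrix ρ id).det ≠ 0 := by
  classical
  have hrank : A.rank = Fintype.card κ := by
    have hinj : Function.Injective A.mulVecLin := fun x y h => hA h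
    rw [Matrix.rank, LinearMap.finrank_range_of_inj hinj, Module.finrank_fintype_fun_eq_card]
  obtain ⟨κ', a, ha, hspan, hli⟩ := exists_linearIndependent' (K := ℂ) A.row
  haveI : Finite κ' := hli.finite
  letI : Fintype κ' := Fintype.ofFinite κ'
  have hcard : Fintype.card κ' = Fintype.card κ := by
    rw [linearIndependent_iff_card_eq_finrank_span.mp hli, Set.finrank, hspan,
      ← Matrix.rank_eq_finrank_span_row, hrank]
  obtain ⟨e⟩ : Nonempty (κ ≃ κ') := Fintype.card_eq.mp hcard.symm
  refine ⟨a ∘ e, ha.comp e.injective, ?_⟩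
  have hli' : LinearIndependent ℂ (A.submatrix (a ∘ e) id).row := by
    have : (A.submatrix (a ∘ e) id).row = (A.row ∘ a) ∘ e := by
      funext i; rfl
    rw [this]
    exact hli.comp e e.injective
  have hU := Matrix.linearIndependent_rows_iff_isUnit.mp hli'
  rw [Matrix.isUnit_iff_isUnit_det] at hU
  exact hU.ne_zero

namespace TwoLog

open GaGm

variable (b₁ b₂ : ℕ) (α₁ α₂ : ℂˣ)

/-! ### The points `(r b₂ + s b₁, α₁^r α₂^s)` of `𝔾ₐ × 𝔾ₘ` -/

/-- The abscissa `x_{r,s} = r b₂ + s b₁`. [cite: BakerWustholz2007, §2.8 p. 35] -/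
def xc (r s : ℕ) : ℕ := r * b₂ + s * b₁

/-- The ordinate `y_{r,s} = α₁^r α₂^s`. [cite: BakerWustholz2007, §2.8 p. 35] -/
def yc (r s : ℕ) : ℂˣ := α₁ ^ r * α₂ ^ s

/-- `x` is additive. [folklore] -/
theorem xc_add (r r' s s' : ℕ) :
    xc b₁ b₂ (r + r') (s + s') = xc b₁ b₂ r s + xc b₁ b₂ r' s' := by
  unfold xc; ring

/-- `y` is multiplicative. [folklore] -/
theorem yc_add (r r' s s' : ℕ) :
    yc α₁ α₂ (r + r') (s + s') = yc α₁ α₂ r s * yc α₁ α₂ r' s' := by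
  unfold yc; rw [pow_add, pow_add, mul_mul_mul_comm]

/-- The point `g_{r,s} = (x_{r,s}, y_{r,s}) ∈ G(ℂ) = ℂ × ℂˣ`. [cite: BakerWustholz2007, §2.8 p. 35] -/
def pt (r s : ℕ) : GaGm 1 :=
  (Multiplicative.ofAdd ((xc b₁ b₂ r s : ℕ) : ℂ), fun _ => yc α₁ α₂ r s)

/-- `g` is a homomorphism. [folklore] -/
theorem pt_add (r r' s s' : ℕ) :
    pt b₁ b₂ α₁ α₂ (r + r') (s + s') = pt b₁ b₂ α₁ α₂ r s * pt b₁ b₂ α₁ α₂ r' s' := by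
  unfold pt
  rw [xc_add, yc_add, Nat.cast_add, ofAdd_add]
  rfl

/-- `g_{0,0} = e`. [folklore] -/
theorem pt_zero : pt b₁ b₂ α₁ α₂ 0 0 = 1 := by
  unfold pt xc yc
  ext j <;> simp

/-- The additive coordinate of `g_{r,s}`. [folklore] -/
@[simp] theorem coord_pt_zero (r s : ℕ) : coord (pt b₁ b₂ α₁ α₂ r s) 0 = (xc b₁ b₂ r s : ℂ) := by
  simp [pt]

/-- The multiplicative coordinate of `g_{r,s}`. [folklore] -/
@[simp] theorem coord_pt_one (r s : ℕ) :
    coord (pt b₁ b₂ α₁ α₂ r s) (Fin.succ 0) = ((yc α₁ α₂ r s : ℂˣ) : ℂ) := by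
  rw [coord_succ]; rfl

/-! ### The polynomial with a given coefficient table -/

variable {K L : ℕ}

/-- The exponent vector of the monomial `X^k Y^l`. [folklore] -/
def expo (j : Fin K × Fin L) : Fin (1 + 1) →₀ ℕ :=
  Finsupp.single 0 (j.1 : ℕ) + Finsupp.single (Fin.succ 0) (j.2 : ℕ)

/-- `expo j` at `0` is `k`. [folklore] -/
@[simp] theorem expo_zero (j : Fin K × Fin L) : expo j 0 = (j.1 : ℕ) := by
  simp [expo]

/-- `expo j` at `1` is `l`. [folklore] -/
@[simp] theorem expo_one (j : Fin K × Fin L) : expo j (Fin.succ 0) = (j.2 : ℕ) := by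
  simp [expo]

/-- `expo` is injective. [folklore] -/
theorem expo_injective : Function.Injective (expo (K := K) (L := L)) := by
  intro j j' h
  have h0 := congrArg (fun m => m 0) h
  have h1 := congrArg (fun m => m (Fin.succ 0)) h
  simp only [expo_zero, expo_one] at h0 h1
  exact Prod.ext (Fin.ext h0) (Fin.ext h1)

/-- `P_c = ∑_{k,l} c_{k,l} X^k Y^l`. [cite: BakerWustholz2007, §2.8 p. 35] -/
def poly (c : Fin K × Fin L → ℂ) : MvPolynomial (Fin (1 + 1)) ℂ :=
  ∑ j : Fin K × Fin L, monomial (expo j) (c j)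

/-- The coefficients of `P_c` are the `c_{k,l}`. [folklore] -/
theorem coeff_poly (c : Fin K × Fin L → ℂ) (j : Fin K × Fin L) : coeff (expo j) (poly c) = c j := by
  classical
  rw [poly, coeff_sum]
  simp_rw [coeff_monomial]
  rw [Finset.sum_eq_single j]
  · simp
  · intro j' _ hj'
    rw [if_neg fun h => hj' (expo_injective h)]
  · intro h; exact absurd (Finset.mem_univ j) h

/-- `P_c = 0` forces `c = 0`. [folklore] -/
theorem eq_zero_of_poly_eq_zero {c : Fin K × Fin L → ℂ} (h : poly c = 0) : c = 0 := by
  funext j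
  rw [← coeff_poly c j, h, coeff_zero]
  rfl

/-- The support of `P_c` consists of exponent vectors `expo j`. [folklore] -/
theorem exists_eq_expo_of_mem_support (c : Fin K × Fin L → ℂ) {m : Fin (1 + 1) →₀ ℕ}
    (hm : m ∈ (poly c).support) : ∃ j : Fin K × Fin L, m = expo j := by
  classical
  rw [poly] at hm
  obtain ⟨j, _, hj⟩ := Finset.mem_biUnion.mp (support_sum hm)
  exact ⟨j, Finset.mem_singleton.mp (support_monomial_subset hj)⟩

/-- `deg_X P_c ≤ K - 1`. [folklore] -/
theorem degreeOf_poly_zero (c : Fin K × Fin L → ℂ) : (poly c).degreeOf 0 ≤ K - 1 := by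
  rw [degreeOf_le_iff]
  intro m hm
  obtain ⟨j, rfl⟩ := exists_eq_expo_of_mem_support c hm
  rw [expo_zero]; have := j.1.isLt; omega

/-- `deg_Y P_c ≤ L - 1`. [folklore] -/
theorem degreeOf_poly_one (c : Fin K × Fin L → ℂ) : (poly c).degreeOf (Fin.succ 0) ≤ L - 1 := by
  rw [degreeOf_le_iff]
  intro m hm
  obtain ⟨j, rfl⟩ := exists_eq_expo_of_mem_support c hm
  rw [expo_one]; have := j.2.isLt; omega

/-- The value of `P_c` at `g_{r,s}`: `∑ c_{k,l} x_{r,s}^k y_{r,s}^l`. [folklore] -/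
theorem evalAt_poly_pt (c : Fin K × Fin L → ℂ) (r s : ℕ) :
    evalAt (poly c) (pt b₁ b₂ α₁ α₂ r s) =
      ∑ j : Fin K × Fin L, c j * (xc b₁ b₂ r s : ℂ) ^ (j.1 : ℕ) *
        ((yc α₁ α₂ r s : ℂˣ) : ℂ) ^ (j.2 : ℕ) := by
  rw [evalAt, poly, map_sum]
  refine Finset.sum_congr rfl fun j _ => ?_
  have hprod : (expo j).prod (fun n e => coord (pt b₁ b₂ α₁ α₂ r s) n ^ e) =
      (xc b₁ b₂ r s : ℂ) ^ (j.1 : ℕ) * ((yc α₁ α₂ r s : ℂˣ) : ℂ) ^ (j.2 : ℕ) := by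
    rw [expo, Finsupp.prod_add_index' (h := fun n e => coord (pt b₁ b₂ α₁ α₂ r s) n ^ e)
      (fun _ => pow_zero _) (fun _ _ _ => pow_add _ _ _),
      Finsupp.prod_single_index (h := fun n e => coord (pt b₁ b₂ α₁ α₂ r s) n ^ e) (pow_zero _),
      Finsupp.prod_single_index (h := fun n e => coord (pt b₁ b₂ α₁ α₂ r s) n ^ e) (pow_zero _),
      coord_pt_zero, coord_pt_one]
  rw [eval_monomial, hprod, mul_assoc]

/-! ### Subgroups of `𝔾ₐ × 𝔾ₘ` (`n = 1`) -/

/-- A saturated subgroup of `ℤ¹` is `0` or everything. [folklore] -/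
theorem chars_eq_bot_or_top (H : ConnAlgSubgroup 1) : H.chars = ⊥ ∨ H.chars = ⊤ := by
  by_cases h : ∃ χ ∈ H.chars, χ ≠ 0
  · right
    obtain ⟨χ, hχ, hχ0⟩ := h
    have hrepr : ∀ ψ : Fin 1 → ℤ, ψ = (ψ 0) • (fun _ => (1 : ℤ)) := fun ψ => by
      funext j; rw [Subsingleton.elim j 0]; simp
    have hc0 : χ 0 ≠ 0 := fun h0 => hχ0 (by rw [hrepr χ, h0, zero_smul])
    have he : (fun _ => (1 : ℤ)) ∈ H.chars := H.saturated (χ 0) _ hc0 (by rw [← hrepr χ]; exact hχ)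
    rw [eq_top_iff]
    intro ψ _
    rw [hrepr ψ]
    exact H.chars.zsmul_mem he _
  · left
    push Not at h
    rw [eq_bot_iff]
    intro χ hχ
    exact h χ hχ

/-- Membership in `H = V × T_A`. [folklore] -/
theorem mem_toSubgroup_iff (H : ConnAlgSubgroup 1) (g : GaGm 1) :
    g ∈ H.toSubgroup ↔
      (H.addPart = false → g.1 = 1) ∧ ∀ χ ∈ H.chars, ∏ j, (g.2 j) ^ (χ j) = 1 := Iff.rfl

/-- With no characters the torus part is all of `𝔾ₘ` (`dim = 1`). [folklore] -/
theorem torusDim_eq_one_of_chars_eq_bot (H : ConnAlgSubgroup 1) (h : H.chars = ⊥) :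
    H.torusDim = 1 := by
  have htop : H.torusTangent = ⊤ := by
    rw [eq_top_iff]
    intro v _ χ hχ
    rw [h, AddSubgroup.mem_bot] at hχ
    subst hχ; simp
  rw [ConnAlgSubgroup.torusDim, htop, finrank_top, Module.finrank_fintype_fun_eq_card,
    Fintype.card_fin]

/-! ### The zero lemma -/

variable {b₁ b₂ α₁ α₂}

/-- The grid `[0, R) × [0, S)`. [folklore] -/
def grid (R S : ℕ) : Finset (ℕ × ℕ) := Finset.range R ×ˢ Finset.range S

/-- Counting classes of `Σ = g(grid)` modulo `H`: if `mk` is injective on `Σ` and `g` is injective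
on the grid then there are `R S` classes. [folklore] -/
theorem ncard_image_mk {R S : ℕ} (H : ConnAlgSubgroup 1)
    (hinj : Set.InjOn (fun p : ℕ × ℕ => pt b₁ b₂ α₁ α₂ p.1 p.2) ↑(grid R S))
    (hmk : Set.InjOn (QuotientGroup.mk : GaGm 1 → GaGm 1 ⧸ H.toSubgroup)
      ((fun p : ℕ × ℕ => pt b₁ b₂ α₁ α₂ p.1 p.2) '' ↑(grid R S))) :
    Set.ncard ((QuotientGroup.mk : GaGm 1 → GaGm 1 ⧸ H.toSubgroup) ''
      ((fun p : ℕ × ℕ => pt b₁ b₂ α₁ α₂ p.1 p.2) '' ↑(grid R S))) = R * S := by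
  rw [hmk.ncard_image, hinj.ncard_image, Set.ncard_coe_finset, grid, Finset.card_product,
    Finset.card_range, Finset.card_range]

/-- **The zero lemma for two logarithms** (Philippon's zero estimate on `𝔾ₐ × 𝔾ₘ` applied to
`Σ = {(r b₂ + s b₁, α₁^r α₂^s) ; r < R, s < S}`): if `K, L ≥ 2`, `R S > 2(K-1)(L-1)`, the
abscissae `r b₂ + s b₁` and the ordinates `α₁^r α₂^s` (`r < R`, `s < S`) are pairwise distinct,
and `∑ c_{k,l} x_{r,s}^k y_{r,s}^l = 0` for all `r < 2R - 1`, `s < 2S - 1`, then `c = 0`.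
[cite: Philippon1986, Thm 2.1 (G = 𝔾ₐ × 𝔾ₘ, T = 0)] -/
theorem eq_zero_of_vanish {R S : ℕ} (hK : 2 ≤ K) (hL : 2 ≤ L)
    (hRS : 2 * (K - 1) * (L - 1) < R * S)
    (hx : Set.InjOn (fun p : ℕ × ℕ => xc b₁ b₂ p.1 p.2) ↑(grid R S))
    (hy : Set.InjOn (fun p : ℕ × ℕ => yc α₁ α₂ p.1 p.2) ↑(grid R S))
    (c : Fin K × Fin L → ℂ)
    (hvan : ∀ r s : ℕ, r < 2 * R - 1 → s < 2 * S - 1 →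
      ∑ j : Fin K × Fin L, c j * (xc b₁ b₂ r s : ℂ) ^ (j.1 : ℕ) *
        ((yc α₁ α₂ r s : ℂˣ) : ℂ) ^ (j.2 : ℕ) = 0) :
    c = 0 := by
  classical
  by_contra hc
  have hP0 : poly c ≠ 0 := fun h => hc (eq_zero_of_poly_eq_zero h)
  have hRpos : 0 < R := Nat.pos_of_ne_zero fun h => by subst h; simp at hRS
  have hSpos : 0 < S := Nat.pos_of_ne_zero fun h => by subst h; simp at hRS
  set Sset : Set (GaGm 1) := (fun p : ℕ × ℕ => pt b₁ b₂ α₁ α₂ p.1 p.2) '' ↑(grid R S) with hSset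
  have h1 : (1 : GaGm 1) ∈ Sset :=
    ⟨(0, 0), by simp [grid, hRpos, hSpos], pt_zero b₁ b₂ α₁ α₂⟩
  have hfin : Sset.Finite := (Finset.finite_toSet _).image _
  have hvan' : ∀ g ∈ sumset Sset (1 + 1), evalAt (poly c) g = 0 := by
    rintro g ⟨σ, hσ, rfl⟩
    obtain ⟨p₀, hp₀, h₀⟩ := hσ 0
    obtain ⟨p₁, hp₁, h₁⟩ := hσ 1
    simp only [grid, Finset.coe_product, Finset.coe_range, Set.mem_prod, Set.mem_Iio] at hp₀ hp₁
    rw [Fin.prod_univ_two, ← h₀, ← h₁, ← pt_add, evalAt_poly_pt]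
    exact hvan _ _ (by omega) (by omega)
  obtain ⟨H, ⟨g, hg⟩, hcount, -, -⟩ := Philippon1986_GaGm_P1n_holds 1 (K - 1) (L - 1) Sset (poly c)
    (by omega) (by omega) hfin h1 hP0 (degreeOf_poly_zero c)
    (fun h => by rw [Subsingleton.elim h 0]; exact degreeOf_poly_one c) hvan'
  -- injectivity of `g` on the grid (from the distinct abscissae)
  have hinj : Set.InjOn (fun p : ℕ × ℕ => pt b₁ b₂ α₁ α₂ p.1 p.2) ↑(grid R S) := by
    intro p hp p' hp' h
    apply hx hp hp'
    have := congrArg (fun g : GaGm 1 => Multiplicative.toAdd g.1) h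
    simpa [pt] using this
  -- injectivity of `mk` on `Σ` from a separating coordinate
  have hmk_of_x : (∀ u u' : GaGm 1, (QuotientGroup.mk u : GaGm 1 ⧸ H.toSubgroup) = QuotientGroup.mk u' →
      u.1 = u'.1) → Set.InjOn (QuotientGroup.mk : GaGm 1 → GaGm 1 ⧸ H.toSubgroup) Sset := by
    intro hsep u hu u' hu' h
    obtain ⟨p, hp, rfl⟩ := hu
    obtain ⟨p', hp', rfl⟩ := hu'
    have h1 := hsep _ _ h
    have : xc b₁ b₂ p.1 p.2 = xc b₁ b₂ p'.1 p'.2 := by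
      have := congrArg Multiplicative.toAdd h1
      simpa [pt] using this
    rw [hx hp hp' this]
  have hmk_of_y : (∀ u u' : GaGm 1, (QuotientGroup.mk u : GaGm 1 ⧸ H.toSubgroup) = QuotientGroup.mk u' →
      u.2 0 = u'.2 0) → Set.InjOn (QuotientGroup.mk : GaGm 1 → GaGm 1 ⧸ H.toSubgroup) Sset := by
    intro hsep u hu u' hu' h
    obtain ⟨p, hp, rfl⟩ := hu
    obtain ⟨p', hp', rfl⟩ := hu'
    have h1 := hsep _ _ h
    have : yc α₁ α₂ p.1 p.2 = yc α₁ α₂ p'.1 p'.2 := by simpa [pt] using h1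
    rw [hy hp hp' this]
  rcases chars_eq_bot_or_top H with hbot | htop <;> cases hadd : H.addPart
  · -- `H = 0 × 𝔾ₘ`: classes are abscissae
    have hsep : ∀ u u' : GaGm 1, (QuotientGroup.mk u : GaGm 1 ⧸ H.toSubgroup) = QuotientGroup.mk u' →
        u.1 = u'.1 := by
      intro u u' h
      rw [QuotientGroup.eq, mem_toSubgroup_iff] at h
      have := h.1 hadd
      simpa [inv_mul_eq_one] using this
    rw [ncard_image_mk H hinj (hmk_of_x hsep), torusDim_eq_one_of_chars_eq_bot H hbot,
      ConnAlgSubgroup.addDim, hadd] at hcount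
    simp only [Bool.false_eq_true, ↓reduceIte, pow_zero, mul_one, pow_one, Nat.factorial] at hcount
    have h2 : R * S ≤ 2 * (K - 1) := Nat.le_of_mul_le_mul_right (by linarith) (by omega : 0 < L - 1)
    have h3 : 2 * (K - 1) ≤ 2 * (K - 1) * (L - 1) := Nat.le_mul_of_pos_right _ (by omega)
    omega
  · -- `H = G`: `P` vanishes everywhere
    have hall : ∀ u : GaGm 1, evalAt (poly c) u = 0 := by
      intro u
      have hmem : g⁻¹ * u ∈ H.toSubgroup := by
        rw [mem_toSubgroup_iff]
        refine ⟨fun h => absurd (h.symm.trans hadd) (by simp), fun χ hχ => ?_⟩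
        rw [hbot, AddSubgroup.mem_bot] at hχ
        subst hχ; simp
      have := hg _ hmem
      rwa [mul_inv_cancel_left] at this
    exact hP0 (DiazZL.eq_zero_of_forall_evalAt _ hall)
  · -- `H = {e}`: classes are points
    have hsep : ∀ u u' : GaGm 1, (QuotientGroup.mk u : GaGm 1 ⧸ H.toSubgroup) = QuotientGroup.mk u' →
        u.1 = u'.1 := by
      intro u u' h
      rw [QuotientGroup.eq, mem_toSubgroup_iff] at h
      have := h.1 hadd
      simpa [inv_mul_eq_one] using this
    rw [ncard_image_mk H hinj (hmk_of_x hsep), ConnAlgSubgroup.addDim, hadd] at hcount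
    simp only [Bool.false_eq_true, ↓reduceIte, pow_zero, mul_one, Nat.factorial] at hcount
    have hpow : 1 ≤ (L - 1) ^ H.torusDim := Nat.one_le_pow _ _ (by omega)
    have h2 : R * S ≤ R * S * (L - 1) ^ H.torusDim := Nat.le_mul_of_pos_right _ hpow
    have h3 : R * S ≤ 2 * (K - 1) * (L - 1) := by
      have := h2.trans hcount; simpa [mul_comm, mul_assoc, mul_left_comm] using this
    omega
  · -- `H = 𝔾ₐ × 1`: classes are ordinates
    have hsep : ∀ u u' : GaGm 1, (QuotientGroup.mk u : GaGm 1 ⧸ H.toSubgroup) = QuotientGroup.mk u' →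
        u.2 0 = u'.2 0 := by
      intro u u' h
      rw [QuotientGroup.eq, mem_toSubgroup_iff] at h
      have := h.2 (fun _ => 1) (by rw [htop]; exact AddSubgroup.mem_top _)
      simp only [Fin.prod_univ_one, zpow_one, Prod.snd_mul, Prod.snd_inv, Pi.mul_apply,
        Pi.inv_apply, inv_mul_eq_one] at this
      exact this
    rw [ncard_image_mk H hinj (hmk_of_y hsep), ConnAlgSubgroup.addDim, hadd] at hcount
    simp only [↓reduceIte, pow_one, Nat.factorial] at hcount
    have hpow : 1 ≤ (L - 1) ^ H.torusDim := Nat.one_le_pow _ _ (by omega)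
    have h2 : R * S * (K - 1) ≤ R * S * (K - 1) * (L - 1) ^ H.torusDim :=
      Nat.le_mul_of_pos_right _ hpow
    have h3 : R * S * (K - 1) ≤ 2 * (K - 1) * (L - 1) := by
      have := h2.trans hcount; simpa [mul_comm, mul_assoc, mul_left_comm] using this
    have h4 : R * S ≤ 2 * (L - 1) := by
      refine Nat.le_of_mul_le_mul_right ?_ (by omega : 0 < K - 1)
      calc R * S * (K - 1) ≤ 2 * (K - 1) * (L - 1) := h3
        _ = 2 * (L - 1) * (K - 1) := by ring
    have h5 : 2 * (L - 1) ≤ 2 * (K - 1) * (L - 1) := by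
      calc 2 * (L - 1) = 2 * 1 * (L - 1) := by ring
        _ ≤ 2 * (K - 1) * (L - 1) := by gcongr; omega
    omega

/-- **A non-singular interpolation matrix on the grid.** Under the hypotheses of the zero lemma
(without the vanishing), some `KL` points `(r_i, s_i)` of the big grid `r < 2R - 1`, `s < 2S - 1`
make the `KL × KL` matrix `(x_{r_i,s_i}^k · y_{r_i,s_i}^l)_{i,(k,l)}` non-singular.
[cite: Philippon1986, Thm 2.1 (G = 𝔾ₐ × 𝔾ₘ, T = 0)] -/
theorem exists_det_ne_zero {R S : ℕ} (hK : 2 ≤ K) (hL : 2 ≤ L)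
    (hRS : 2 * (K - 1) * (L - 1) < R * S)
    (hx : Set.InjOn (fun p : ℕ × ℕ => xc b₁ b₂ p.1 p.2) ↑(grid R S))
    (hy : Set.InjOn (fun p : ℕ × ℕ => yc α₁ α₂ p.1 p.2) ↑(grid R S)) :
    ∃ ρ : Fin K × Fin L → ℕ × ℕ, (∀ i, (ρ i).1 < 2 * R - 1 ∧ (ρ i).2 < 2 * S - 1) ∧
      Function.Injective ρ ∧
      Matrix.det (Matrix.of fun (i j : Fin K × Fin L) =>
        (xc b₁ b₂ (ρ i).1 (ρ i).2 : ℂ) ^ (j.1 : ℕ) *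
          ((yc α₁ α₂ (ρ i).1 (ρ i).2 : ℂˣ) : ℂ) ^ (j.2 : ℕ)) ≠ 0 := by
  classical
  set A : Matrix (Fin (2 * R - 1) × Fin (2 * S - 1)) (Fin K × Fin L) ℂ :=
    Matrix.of fun p j => (xc b₁ b₂ p.1 p.2 : ℂ) ^ (j.1 : ℕ) *
      ((yc α₁ α₂ p.1 p.2 : ℂˣ) : ℂ) ^ (j.2 : ℕ) with hA
  have hA0 : ∀ c, A.mulVec c = 0 → c = 0 := by
    intro c hc
    refine eq_zero_of_vanish hK hL hRS hx hy c fun r s hr hs => ?_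
    have := congrFun hc (⟨r, hr⟩, ⟨s, hs⟩)
    simp only [Matrix.mulVec, dotProduct, hA, Matrix.of_apply, Pi.zero_apply] at this
    rw [← this]
    exact Finset.sum_congr rfl fun j _ => by ring
  have hAinj : Function.Injective A.mulVec := by
    intro c c' h
    have h0 : A.mulVec (c - c') = 0 := by rw [Matrix.mulVec_sub, h, sub_self]
    exact sub_eq_zero.mp (hA0 _ h0)
  obtain ⟨ρ, hρ, hdet⟩ := exists_submatrix_det_ne_zero A hAinj
  refine ⟨fun i => ((ρ i).1, (ρ i).2), fun i => ⟨(ρ i).1.isLt, (ρ i).2.isLt⟩, ?_, ?_⟩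
  · intro i i' h
    apply hρ
    simp only [Prod.mk.injEq] at h
    exact Prod.ext (Fin.ext h.1) (Fin.ext h.2)
  · simpa [Matrix.submatrix, hA] using hdet

end TwoLog

end Literature.NumberTheory.Transcendental

end
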